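/-
Copyright (c) 2026 the pub-hodgecm-mathlib formalisation cell (harness21).  Prover seat hodgecm-mathlib-K2E1-p12 (g0), Track B ∕ K2-LIT, h413 = `stmt-HodgeConjecture-24833`,
line `K2_E1_TraceFormulaBeta`, campaign «R8₂-sph EXHAUSTION», f3-sph «inner product formula for spherical pseudo-Eisenstein series» FILE D (dealer K2E1-plan (g6) deal (103)
2026-09-04T10:53Z; census memo of K2E3-p12 (g7) `K2/K2E3-p12/g7/CENSUS-f3sph-PseudoEisensteinInnerProductCMTwo.K2E3-p12-g7.md`).  ED. 1: the MELLIN ALGEBRA letter-free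
(steps 4, 7, 8 of the memo's chain) — hypothesis-first on the two measure-bookkeeping identities `hweight` (steps 1–3) and `hradial` (steps 5–6), paid in ED. 2∕3.
-/
import Summits.HodgeConjecture.HodgeConjecture.Theorems.K2E1SphericalIntertwiningMellinCMTwo   -- ★ B p859488 (K2E1-p13 g0): (GM) `∫ f(H(w₀vg)) dν = (2π)⁻¹∫ f̃ c H(g)^{1−z} dy`, `c` continuous∕bounded on `Re = σ₀`; brings ★ A p859444 (Parseval I∕II)
import Summits.HodgeConjecture.HodgeConjecture.Theorems.K2E1EisensteinSeriesLeftRight           -- ★ R3 (K2E1-p08): `eisensteinSeriesU`, `borelConstantTerm_eisensteinSeriesU_two` (the shape of `hweight`)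
import Literature.NumberTheory.Automorphic.AutomorphicRepsGLCuspidalUnitary                       -- ★ `AdelicGroupData.quotFun`
import HarnessLib

/-!
# f3-sph FILE D — `K2E1PseudoEisensteinInnerProductCMTwo` (ED. 1): the inner product formula for spherical pseudo-Eisenstein series on `U(1,1)_{L∕L⁺}`
# [MW II.2.1], Mellin side letter-free, measure bookkeeping as two letters

Track B ∕ K2-LIT, crux h413 = `stmt-HodgeConjecture-24833`, route of record `HCCMUnconditional`; cell `hodgecm-mathlib`, squad K2, ENGINE E1.  THEOREMS ONLY (no `def`, no `instance`,
no `notation`, no `sorry`; default heartbeats); lane `--supports stmt-HodgeConjecture-24833 --as helper` (count-neutral).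

THE MATHEMATICS ([MoeglinWaldspurger1995, II.1.4, II.1.6–II.1.8, II.2.1]; [Garrett2018, §1.10–1.12, §2.8]; [Titchmarsh1948, Thm 71–72]).  `G = U(1,1)` quasi-split over the CM extension
`L∕L⁺`, `H : G(𝔸) → ℝ_{>0}` the Borel height, `θ_f = E(f∘H)` the pseudo-Eisenstein series of `f ∈ C²_c((0,∞))` (LEFT convention ★ `eisensteinSeriesU`), `f̃(z) := mellin f (−z)` (entire),
`c(z) := ∫_{N(𝔸)} H(w₀v)^z dν` the standard intertwining scalar.  MW II.2.1 computes `⟪θ_f, θ_{f′}⟫_{L²(X)}` in three moves: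
(W) unfolding + adjunction to the constant term + `CT(θ_{f′}) = f′∘H + (ν𝓕)⁻¹•M(f′∘H)` give `⟪θ_f, θ_{f′}⟫ = c_μ ∫_{G(𝔸)} β·(f∘H)·conj(f′∘H + (ν𝓕)⁻¹•M(f′∘H)) dν_G` — the letter **`hweight`** (★ chain
`integrable_tsum_borelQuotient_and_integral_eq_mul_integral_fin` ∘ `integral_wt_smul_mul_conj_eq_mul_conj_borelConstantTerm_two` ∘ `borelConstantTerm_eisensteinSeriesU_two`, ED. 2);
(R) Iwasawa + Tate's `d^×x = d𝔟·dr∕r` turn a `β`-weighted integral of a RADIAL function into `K_r ∫_0^∞ Ψ(r) r^{−2} dr` — the letter **`hradial`** (★ (δ)_two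
`exists_integral_weight_smul_eq_mul_setIntegral_ideleClass_two` ∘ ★ (GR) `setIntegral_inv_ideleNorm_smul_comp_eq`, ED. 3);
(M) the MELLIN SIDE, PROVED HERE LETTER-FREE: by ★ B (GM) `M(f′∘H)(g) = (2π)⁻¹∫_ℝ f̃′(z)c(z)H(g)^{1−z} dy` (`z = σ₀+iy`, `σ₀ > 1`) the weight-level integrand IS radial, `Ψ(r) = f(r)·conj(f′(r) +
(ν𝓕)⁻¹(Mf′)(r))`, `Ψ ∈ C_c((0,∞))` (§1: continuity of the parametric line integral by dominated convergence), and ★ A's two Parseval identities evaluate `∫_0^∞ Ψ(r) r^{−2} dr =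
(2π)⁻¹ ∫_ℝ f̃(z)·(conj f̃′(1−z̄) + (ν𝓕)⁻¹·c(z)·conj f̃′(z̄)) dy` (§1 `setIntegral_radialPairing_mul_cpow_eq`, with the reflection `conj c(z̄) = c(z)` of §2, `H` being positive real).
HENCE (§3 HEAD of ED. 1) **`pseudoEisenstein_inner_product_cm_two_of_letters`**: `⟪θ_f, θ_{f′}⟫_X = c_μ·K_r·(2π)⁻¹ ∫_ℝ f̃(z)·(conj f̃′(1−z̄) + (ν𝓕)⁻¹ c(z) conj f̃′(z̄)) dy` on `Re z = σ₀ > 1`.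
BYTE NOTE: Mathlib has `Complex.VerticalIntegrable` but no `VerticalIntegral`; the memo's `C · VerticalIntegral F σ₀ ∕ (2πi)` is spelled `C * ((2π)⁻¹ * ∫ y, F (σ₀ + y I))` (equal: `dz = i dy`),
exactly ★ A∕B's currency.
* §1 (pure analysis on `(0,∞)`, generic coefficient `c` continuous∕bounded on the line): `continuousAt_integral_mellin_mul_cpow`, `continuous_mul_of_continuousAt_Ioi`,
  `setIntegral_radialPairing_mul_cpow_eq`.  * §2 `conj_integral_ofReal_cpow_conj` (reflection).  * §3 (CM, `U(1,1)`): **`integral_weight_smul_radialPairing_eq_mellin_cm_two`** (letter `hradial`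
  only) and the HEAD **`pseudoEisenstein_inner_product_cm_two_of_letters`** (letters `hweight`, `hradial`).
HONEST LABEL: HC_CM is proved only modulo the 7 printed citations (2 remaining named inputs: hLiu418 = `stmt-HodgeConjecture-24832`, h413 = `stmt-HodgeConjecture-24833`) until rung 0
closes; this file asserts no named fact, closes no socket; count-neutral; two letters (`hweight`, `hradial`), both ★-payable (ED. 2∕3).

## References
* [MoeglinWaldspurger1995] C. Mœglin, J.-L. Waldspurger, *Spectral decomposition and Eisenstein series* (1995), II.1.4, II.1.6–II.1.8, II.2.1.
* [Garrett2018] P. Garrett, *Modern Analysis of Automorphic Forms by Example* (2018), §1.10–1.12, §2.8.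
* [Titchmarsh1948] E. C. Titchmarsh, *Introduction to the Theory of Fourier Integrals* (1948), Thm 71–72.
-/

set_option autoImplicit false
set_option linter.dupNamespace false  -- the mandated namespace repeats the summit's segment (`HodgeConjecture.HodgeConjecture`)

noncomputable section

open MeasureTheory Measure Set Filter Topology Complex NumberField IsDedekindDomain
open scoped Real NNReal ENNReal ComplexConjugate
open Literature.NumberTheory.Automorphic Literature.NumberTheory.Automorphic.UnitaryGroup AdelicGroupData
open Summit.HodgeConjecture.HodgeConjecture.Cruxes.H413.K2E1BorelEisensteinU (eisensteinSeriesU)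
open Summit.HodgeConjecture.HodgeConjecture.Cruxes.H413.K2E1MellinPaleyWienerHalfLine
open Summit.HodgeConjecture.HodgeConjecture.Cruxes.H413.K2E1SphericalIntertwiningMellinCMTwo

namespace Summit.HodgeConjecture.HodgeConjecture.Cruxes.H413.K2E1PseudoEisensteinInnerProductCMTwo

/-! ## §1 Pure analysis on `(0,∞)`: the radial pairing against `r^{−2} dr` through ★ A's Parseval identities -/

section Analysis

variable {f g : ℝ → ℂ}

/-- **The parametric line integral `r ↦ ∫_ℝ g̃(z)·c(z)·r^{1−z} dy` (`z = σ₀+iy`, `σ₀ ≥ 1`) is continuous at every `r₀ > 0`** — dominated convergence (Mathlib `continuousAt_of_dominated`):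
on `r > r₀∕2` the integrand is majorised by `‖g̃(σ₀+iy)‖·C₀·(r₀∕2)^{1−σ₀}` (`r^{1−σ₀}` is antitone), integrable by ★ A `verticalIntegrable_mellin`. [cite: MoeglinWaldspurger1995, II.1.4] -/
theorem continuousAt_integral_mellin_mul_cpow (hg : ContDiff ℝ 2 g) (hgs : HasCompactSupport g) (hg0 : tsupport g ⊆ Ioi 0) {σ₀ : ℝ} (hσ₀ : 1 ≤ σ₀)
    {c : ℂ → ℂ} (hcc : Continuous fun y : ℝ => c ((σ₀ : ℂ) + y * I)) {C₀ : ℝ} (hcb : ∀ y : ℝ, ‖c ((σ₀ : ℂ) + y * I)‖ ≤ C₀) {r₀ : ℝ} (hr₀ : 0 < r₀) :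
    ContinuousAt (fun r : ℝ => ∫ y : ℝ, mellin g (-((σ₀ : ℂ) + y * I)) * c ((σ₀ : ℂ) + y * I) * (r : ℂ) ^ (1 - ((σ₀ : ℂ) + y * I))) r₀ := by
  have hGc : Continuous fun y : ℝ => mellin g (-((σ₀ : ℂ) + y * I)) :=
    (differentiable_mellin hg.continuous hgs hg0).continuous.comp (by fun_prop)
  have hGi : Integrable fun y : ℝ => ‖mellin g (-((σ₀ : ℂ) + y * I))‖ := by
    have h := (verticalIntegrable_mellin hg hgs hg0 (-σ₀)).comp_neg
    refine (h.congr (Eventually.of_forall fun y => ?_)).norm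
    simp only [ofReal_neg]; congr 1; ring
  have hC₀ : 0 ≤ C₀ := (norm_nonneg _).trans (hcb 0)
  have hr₂ : 0 < r₀ / 2 := by positivity
  refine continuousAt_of_dominated (bound := fun y => ‖mellin g (-((σ₀ : ℂ) + y * I))‖ * (C₀ * (r₀ / 2) ^ (1 - σ₀))) ?_ ?_ (hGi.mul_const _) ?_
  · filter_upwards [Ioi_mem_nhds hr₀] with r hr
    exact ((hGc.mul hcc).mul (continuous_const.cpow (continuous_const.sub (by fun_prop)) fun y => ofReal_mem_slitPlane.2 hr)).aestronglyMeasurable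
  · filter_upwards [Ioi_mem_nhds (show r₀ / 2 < r₀ by linarith)] with r hr
    refine Eventually.of_forall fun y => ?_
    have hr0 : 0 < r := hr₂.trans hr
    rw [norm_mul, norm_mul, norm_cpow_eq_rpow_re_of_pos hr0]
    simp only [sub_re, one_re, add_re, ofReal_re, mul_re, I_re, mul_zero, ofReal_im, I_im, mul_one, sub_self, add_zero]
    rw [mul_assoc]
    exact mul_le_mul_of_nonneg_left (mul_le_mul (hcb y) (Real.rpow_le_rpow_of_nonpos hr₂ hr.le (by linarith)) (Real.rpow_nonneg hr0.le _) hC₀) (norm_nonneg _)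
  · exact Eventually.of_forall fun y => continuousAt_const.mul (continuousAt_ofReal_cpow_const r₀ _ (Or.inr hr₀.ne'))

/-- `r ↦ f(r)·h(r)` is continuous on ALL of `ℝ` when `f` is continuous with `tsupport f ⊆ (0,∞)` and `h` is continuous at every `r > 0` (near `r ≤ 0` the product vanishes identically) —
the idiom of ★ A `continuous_ofReal_cpow_mul`. [cite: Titchmarsh1948, §1.29] -/
theorem continuous_mul_of_continuousAt_Ioi {h : ℝ → ℂ} (hfc : Continuous f) (hf0 : tsupport f ⊆ Ioi 0) (hh : ∀ r : ℝ, 0 < r → ContinuousAt h r) :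
    Continuous fun r : ℝ => f r * h r := by
  refine continuous_iff_continuousAt.2 fun t => ?_
  by_cases ht : 0 < t
  · exact hfc.continuousAt.mul (hh t ht)
  · have hmem : t ∉ tsupport f := fun h' => ht (hf0 h')
    have h0 : f =ᶠ[𝓝 t] 0 := notMem_tsupport_iff_eventuallyEq.1 hmem
    refine (continuousAt_const (y := (0 : ℂ))).congr ?_
    filter_upwards [h0] with u hu
    simp only [hu, Pi.zero_apply, zero_mul]

/-- **THE MELLIN SIDE OF MW II.2.1 IN RANK ONE.**  For `f, g ∈ C²_c((0,∞))`, `σ₀ ≥ 1`, a real scalar `a` and a coefficient `c` continuous and bounded on `Re z = σ₀` with the reflection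
`conj c(z̄) = c(z)` there, put `(Mg)(r) := (2π)⁻¹∫_ℝ g̃(z)·c(z)·r^{1−z} dy` (`z = σ₀+iy`, `g̃ = mellin g (−·)`).  Then
`∫_0^∞ f(r)·conj(g(r) + a•(Mg)(r))·r^{−2} dr = (2π)⁻¹ ∫_ℝ f̃(z)·(conj g̃(1−z̄) + a·c(z)·conj g̃(z̄)) dy` — ★ A Parseval I (`w = 1` term) plus `a` times ★ A Parseval II (`w = w₀` term),
the splitting justified by `f·conj g·r^{−2}, f·r^{−2}·conj Mg ∈ L¹((0,∞))` (continuity of `Mg` on `(0,∞)`, compact support of `f`) and by the integrability of both line integrands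
(`f̃ ∈ L¹` of the line ★ A, the other factors bounded ★ A `norm_mellin_le`). [cite: MoeglinWaldspurger1995, II.2.1] [cite: Titchmarsh1948, Thm 71–72] -/
theorem setIntegral_radialPairing_mul_cpow_eq (hf : ContDiff ℝ 2 f) (hfs : HasCompactSupport f) (hf0 : tsupport f ⊆ Ioi 0)
    (hg : ContDiff ℝ 2 g) (hgs : HasCompactSupport g) (hg0 : tsupport g ⊆ Ioi 0) {σ₀ : ℝ} (hσ₀ : 1 ≤ σ₀)
    {c : ℂ → ℂ} (hcc : Continuous fun y : ℝ => c ((σ₀ : ℂ) + y * I)) {C₀ : ℝ} (hcb : ∀ y : ℝ, ‖c ((σ₀ : ℂ) + y * I)‖ ≤ C₀)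
    (hcr : ∀ y : ℝ, conj (c (conj ((σ₀ : ℂ) + y * I))) = c ((σ₀ : ℂ) + y * I)) (a : ℝ) :
    ∫ r in Ioi (0 : ℝ), f r * conj (g r + a • ((((2 * π)⁻¹ : ℝ) : ℂ) * ∫ y : ℝ, mellin g (-((σ₀ : ℂ) + y * I)) * c ((σ₀ : ℂ) + y * I) * (r : ℂ) ^ (1 - ((σ₀ : ℂ) + y * I)))) *
        (r : ℂ) ^ (-2 : ℂ) =
      (((2 * π)⁻¹ : ℝ) : ℂ) * ∫ y : ℝ, mellin f (-((σ₀ : ℂ) + y * I)) *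
        (conj (mellin g (-(1 - conj ((σ₀ : ℂ) + y * I)))) + (a : ℂ) * c ((σ₀ : ℂ) + y * I) * conj (mellin g (-conj ((σ₀ : ℂ) + y * I)))) := by
  set κ : ℂ := (((2 * π)⁻¹ : ℝ) : ℂ) with hκ
  set M : ℝ → ℂ := fun r => κ * ∫ y : ℝ, mellin g (-((σ₀ : ℂ) + y * I)) * c ((σ₀ : ℂ) + y * I) * (r : ℂ) ^ (1 - ((σ₀ : ℂ) + y * I)) with hM
  -- `f̃` on the line: continuity and integrability (★ A)
  have hFc : Continuous fun y : ℝ => mellin f (-((σ₀ : ℂ) + y * I)) :=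
    (differentiable_mellin hf.continuous hfs hf0).continuous.comp (by fun_prop)
  have hFi : Integrable fun y : ℝ => mellin f (-((σ₀ : ℂ) + y * I)) := by
    have h := (verticalIntegrable_mellin hf hfs hf0 (-σ₀)).comp_neg
    refine h.congr (Eventually.of_forall fun y => ?_)
    simp only [ofReal_neg]; congr 1; ring
  have hGd := differentiable_mellin hg.continuous hgs hg0
  -- (1) pointwise expansion of the integrand
  have hexp : ∀ r : ℝ, f r * conj (g r + a • M r) * (r : ℂ) ^ (-2 : ℂ) =
      f r * conj (g r) * (r : ℂ) ^ (-2 : ℂ) + (a : ℂ) * (f r * (r : ℂ) ^ (-2 : ℂ) * conj (M r)) := fun r => by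
    rw [map_add, Complex.real_smul, map_mul, conj_ofReal]; ring
  -- (2) integrability of the two pieces on `(0,∞)`
  have hI1 : IntegrableOn (fun r : ℝ => f r * conj (g r) * (r : ℂ) ^ (-2 : ℂ)) (Ioi 0) := by
    have h1 : Continuous fun r : ℝ => f r * conj (g r) := hf.continuous.mul (continuous_conj.comp hg.continuous)
    have h := integrable_ofReal_cpow_mul (f := fun r : ℝ => f r * conj (g r)) h1 hfs.mul_right (tsupport_mul_subset_left.trans hf0) (-2)
    exact (h.congr (Eventually.of_forall fun r => by simp only; ring)).integrableOn
  have hMc : ∀ r : ℝ, 0 < r → ContinuousAt M r := fun r hr =>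
    continuousAt_const.mul (continuousAt_integral_mellin_mul_cpow hg hgs hg0 hσ₀ hcc hcb hr)
  have hI2 : IntegrableOn (fun r : ℝ => f r * (r : ℂ) ^ (-2 : ℂ) * conj (M r)) (Ioi 0) := by
    have h2 : Continuous fun r : ℝ => f r * ((r : ℂ) ^ (-2 : ℂ) * conj (M r)) :=
      continuous_mul_of_continuousAt_Ioi hf.continuous hf0 fun r hr =>
        (continuousAt_ofReal_cpow_const r _ (Or.inr hr.ne')).mul (continuous_conj.continuousAt.comp (hMc r hr))
    have h : Integrable (fun r : ℝ => f r * ((r : ℂ) ^ (-2 : ℂ) * conj (M r))) := h2.integrable_of_hasCompactSupport hfs.mul_right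
    exact (h.congr (Eventually.of_forall fun r => by simp only; ring)).integrableOn
  -- (3) integrability of the two line integrands
  have hre1 : ∀ y : ℝ, (-(1 - conj ((σ₀ : ℂ) + y * I))).re = σ₀ - 1 := fun y => by
    simp only [neg_re, sub_re, one_re, conj_re, add_re, ofReal_re, mul_re, I_re, mul_zero, ofReal_im, I_im, mul_one, sub_self, add_zero]; ring
  have hre2 : ∀ y : ℝ, (-conj ((σ₀ : ℂ) + y * I)).re = -σ₀ := fun y => by
    simp only [neg_re, conj_re, add_re, ofReal_re, mul_re, I_re, mul_zero, ofReal_im, I_im, mul_one, sub_self, add_zero]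
  have hA : Integrable fun y : ℝ => mellin f (-((σ₀ : ℂ) + y * I)) * conj (mellin g (-(1 - conj ((σ₀ : ℂ) + y * I)))) := by
    refine hFi.mul_bdd (c := ∫ t in Ioi 0, t ^ (σ₀ - 1 - 1) * ‖g t‖) ?_ (Eventually.of_forall fun y => ?_)
    · exact (continuous_conj.comp (hGd.continuous.comp (by fun_prop))).aestronglyMeasurable
    · rw [RCLike.norm_conj, ← hre1 y]; exact norm_mellin_le g _
  have hB : Integrable fun y : ℝ => mellin f (-((σ₀ : ℂ) + y * I)) *
      ((a : ℂ) * c ((σ₀ : ℂ) + y * I) * conj (mellin g (-conj ((σ₀ : ℂ) + y * I)))) := by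
    refine hFi.mul_bdd (c := ‖(a : ℂ)‖ * C₀ * ∫ t in Ioi 0, t ^ (-σ₀ - 1) * ‖g t‖) ?_ (Eventually.of_forall fun y => ?_)
    · exact ((continuous_const.mul hcc).mul (continuous_conj.comp (hGd.continuous.comp (by fun_prop)))).aestronglyMeasurable
    · rw [norm_mul, norm_mul, RCLike.norm_conj]
      have h2 : ‖mellin g (-conj ((σ₀ : ℂ) + y * I))‖ ≤ ∫ t in Ioi 0, t ^ (-σ₀ - 1) * ‖g t‖ := by rw [← hre2 y]; exact norm_mellin_le g _
      exact mul_le_mul (mul_le_mul_of_nonneg_left (hcb y) (norm_nonneg _)) h2 (norm_nonneg _) (mul_nonneg (norm_nonneg _) ((norm_nonneg _).trans (hcb 0)))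
  -- (4) the two Parseval identities (★ A)
  have hP1 := setIntegral_mul_conj_mul_cpow_eq hf hfs hf0 hg.continuous hgs hg0 σ₀
  have hP2 := setIntegral_mul_cpow_mul_conj_integral_eq hf.continuous hfs hf0 hg hgs hg0 σ₀ hcc hcb
  -- (5) assemble
  calc ∫ r in Ioi (0 : ℝ), f r * conj (g r + a • M r) * (r : ℂ) ^ (-2 : ℂ)
      = ∫ r in Ioi (0 : ℝ), (f r * conj (g r) * (r : ℂ) ^ (-2 : ℂ) + (a : ℂ) * (f r * (r : ℂ) ^ (-2 : ℂ) * conj (M r))) :=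
        setIntegral_congr_fun measurableSet_Ioi fun r _ => hexp r
    _ = (∫ r in Ioi (0 : ℝ), f r * conj (g r) * (r : ℂ) ^ (-2 : ℂ)) + (a : ℂ) * ∫ r in Ioi (0 : ℝ), f r * (r : ℂ) ^ (-2 : ℂ) * conj (M r) := by
        rw [integral_add hI1 (hI2.const_mul _), integral_const_mul]
    _ = κ * (∫ y : ℝ, mellin f (-((σ₀ : ℂ) + y * I)) * conj (mellin g (-(1 - conj ((σ₀ : ℂ) + y * I))))) +
          (a : ℂ) * (κ * ∫ y : ℝ, mellin f (-((σ₀ : ℂ) + y * I)) * conj (mellin g (-conj ((σ₀ : ℂ) + y * I))) * conj (c (conj ((σ₀ : ℂ) + y * I)))) := by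
        rw [hP1, hP2]
        congr 3
        funext y
        rw [show -(1 - conj ((σ₀ : ℂ) + y * I)) = conj ((σ₀ : ℂ) + y * I) - 1 by ring]
    _ = κ * ((∫ y : ℝ, mellin f (-((σ₀ : ℂ) + y * I)) * conj (mellin g (-(1 - conj ((σ₀ : ℂ) + y * I))))) +
          ∫ y : ℝ, mellin f (-((σ₀ : ℂ) + y * I)) * ((a : ℂ) * c ((σ₀ : ℂ) + y * I) * conj (mellin g (-conj ((σ₀ : ℂ) + y * I))))) := by
        have hBB : ∫ y : ℝ, (a : ℂ) * (mellin f (-((σ₀ : ℂ) + y * I)) * conj (mellin g (-conj ((σ₀ : ℂ) + y * I))) * conj (c (conj ((σ₀ : ℂ) + y * I)))) =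
            ∫ y : ℝ, mellin f (-((σ₀ : ℂ) + y * I)) * ((a : ℂ) * c ((σ₀ : ℂ) + y * I) * conj (mellin g (-conj ((σ₀ : ℂ) + y * I)))) :=
          integral_congr_ae (Eventually.of_forall fun y => by dsimp only; rw [hcr y]; ring)
        rw [mul_add, mul_left_comm (a : ℂ) κ, ← integral_const_mul (a : ℂ), hBB]
    _ = κ * ∫ y : ℝ, mellin f (-((σ₀ : ℂ) + y * I)) *
          (conj (mellin g (-(1 - conj ((σ₀ : ℂ) + y * I)))) + (a : ℂ) * c ((σ₀ : ℂ) + y * I) * conj (mellin g (-conj ((σ₀ : ℂ) + y * I)))) := by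
        rw [← integral_add hA hB]
        congr 1
        refine integral_congr_ae (Eventually.of_forall fun y => ?_)
        ring

end Analysis

/-! ## §2 The reflection `conj c(z̄) = c(z)` of an integral of powers of a positive real function -/

/-- **`conj (∫ (h v)^{z̄} dν) = ∫ (h v)^z dν`** for a real `h ≥ 0` (`conj (x^{z̄}) = x^z` for real `x ≥ 0`, Mathlib `cpow_conj`; `conj` commutes with the Bochner integral) — applied to
`h(v) = H(w₀v)` this is the reflection `conj c(z̄) = c(z)` of the standard intertwining scalar. [cite: MoeglinWaldspurger1995, II.1.6] -/
theorem conj_integral_ofReal_cpow_conj {α : Type*} [MeasurableSpace α] (ν : Measure α) (h : α → ℝ≥0) (w : ℂ) :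
    conj (∫ v, (((h v : ℝ)) : ℂ) ^ conj w ∂ν) = ∫ v, (((h v : ℝ)) : ℂ) ^ w ∂ν := by
  rw [← integral_conj]
  refine integral_congr_ae (Eventually.of_forall fun v => ?_)
  have harg : (((h v : ℝ)) : ℂ).arg ≠ π := by
    rw [arg_ofReal_of_nonneg (NNReal.coe_nonneg _)]; exact Real.pi_ne_zero.symm
  show conj ((((h v : ℝ)) : ℂ) ^ conj w) = (((h v : ℝ)) : ℂ) ^ w
  rw [cpow_conj _ _ harg, conj_conj, conj_ofReal]

/-! ## §3 `U(1,1)_{L∕L⁺}`: the weight-level identity (letter `hradial`) and the HEAD of ED. 1 (letters `hweight`, `hradial`) -/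

section CM

variable (L : Type) [Field L] [NumberField L] [IsCMField L]
variable [MeasurableSpace (quasiSplit (↥(maximalRealSubfield L)) L (IsCMField.complexConj L) 2).Adelic] [BorelSpace (quasiSplit (↥(maximalRealSubfield L)) L (IsCMField.complexConj L) 2).Adelic]

/-- **THE WEIGHT-LEVEL INNER PRODUCT FORMULA (letter `hradial`)**: for `f, f′ ∈ C²_c((0,∞))`, `σ₀ > 1`, a Haar measure `ν` on `N(𝔸)` with a relatively compact fundamental domain `𝓕`
of `N(F)`, ANY measure `ν_G` and weight `β` on `G(𝔸)` for which `β`-weighted integrals of radial `C_c((0,∞))`-functions are `K_r ∫_0^∞ Ψ(r) r^{−2} dr` (`hradial`, ★ (δ)_two ∘ ★ (GR)):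
`∫ β(g)•(f(Hg)·conj(f′(Hg) + (ν𝓕)⁻¹•∫_{N(𝔸)} f′(H(w₀vg)) dν)) dν_G = K_r·(2π)⁻¹ ∫_ℝ f̃(z)·(conj f̃′(1−z̄) + (ν𝓕)⁻¹·c(z)·conj f̃′(z̄)) dy` (`z = σ₀+iy`) — ★ B makes the integrand
radial (`Ψ(r) = f(r)·conj(f′(r) + (ν𝓕)⁻¹(Mf′)(r))`, continuous with compact support in `(0,∞)` by §1), then §1 `setIntegral_radialPairing_mul_cpow_eq` with ★ B's continuity∕bound of `c`
on the line and §2's reflection. [cite: MoeglinWaldspurger1995, II.2.1] [cite: Garrett2018, §2.8] -/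
theorem integral_weight_smul_radialPairing_eq_mellin_cm_two
    (ν : Measure ↥(adelicUnipotent (↥(maximalRealSubfield L)) L (IsCMField.complexConj L) 2)) [ν.IsHaarMeasure] {𝓕 : Set ↥(adelicUnipotent (↥(maximalRealSubfield L)) L (IsCMField.complexConj L) 2)}
    (h𝓕N : IsFundamentalDomain ↥(rationalUnipotent (↥(maximalRealSubfield L)) L (IsCMField.complexConj L) 2) 𝓕 ν) (h𝓕c : IsCompact (closure 𝓕))
    {f f' : ℝ → ℂ} (hf : ContDiff ℝ 2 f) (hfs : HasCompactSupport f) (hf0 : tsupport f ⊆ Ioi 0) (hf' : ContDiff ℝ 2 f') (hf's : HasCompactSupport f') (hf'0 : tsupport f' ⊆ Ioi 0)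
    {σ₀ : ℝ} (hσ₀ : 1 < σ₀)
    (νG : Measure (quasiSplit (↥(maximalRealSubfield L)) L (IsCMField.complexConj L) 2).Adelic) (β : (quasiSplit (↥(maximalRealSubfield L)) L (IsCMField.complexConj L) 2).Adelic → ℝ≥0∞) {Kr : ℂ}
    (hradial : ∀ Ψ : ℝ → ℂ, Continuous Ψ → HasCompactSupport Ψ → tsupport Ψ ⊆ Ioi 0 →
      ∫ g, (β g).toReal • Ψ (borelHeight g : ℝ) ∂νG = Kr * ∫ r in Ioi (0 : ℝ), Ψ r * (r : ℂ) ^ (-2 : ℂ)) :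
    ∫ g, (β g).toReal • (f (borelHeight g : ℝ) * conj (f' (borelHeight g : ℝ) + ((ν 𝓕).toReal⁻¹ : ℝ) •
        ∫ v : ↥(adelicUnipotent (↥(maximalRealSubfield L)) L (IsCMField.complexConj L) 2), f' ((borelHeight ((quasiSplit (↥(maximalRealSubfield L)) L (IsCMField.complexConj L) 2).toAdelic
          (weylLongU ((IsCMField.complexConj L : L ≃ₐ[↥(maximalRealSubfield L)] L) : L →+* L) (rfl : (StdForm.antidiagonal 2).over L = (StdForm.antidiagonal 2).over L)) *
            (v : (quasiSplit (↥(maximalRealSubfield L)) L (IsCMField.complexConj L) 2).Adelic) * g)) : ℝ) ∂ν)) ∂νG =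
      Kr * ((((2 * π)⁻¹ : ℝ) : ℂ) * ∫ y : ℝ, mellin f (-((σ₀ : ℂ) + y * I)) *
        (conj (mellin f' (-(1 - conj ((σ₀ : ℂ) + y * I)))) + (((ν 𝓕).toReal⁻¹ : ℝ) : ℂ) *
          (∫ v : ↥(adelicUnipotent (↥(maximalRealSubfield L)) L (IsCMField.complexConj L) 2), (((borelHeight ((quasiSplit (↥(maximalRealSubfield L)) L (IsCMField.complexConj L) 2).toAdelic
            (weylLongU ((IsCMField.complexConj L : L ≃ₐ[↥(maximalRealSubfield L)] L) : L →+* L) (rfl : (StdForm.antidiagonal 2).over L = (StdForm.antidiagonal 2).over L)) *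
              (v : (quasiSplit (↥(maximalRealSubfield L)) L (IsCMField.complexConj L) 2).Adelic))) : ℝ) : ℂ) ^ (((σ₀ : ℂ) + y * I)) ∂ν) *
          conj (mellin f' (-conj ((σ₀ : ℂ) + y * I))))) := by
  -- the intertwining scalar on the line and its three properties (★ B, §2)
  set c : ℂ → ℂ := fun w => ∫ v : ↥(adelicUnipotent (↥(maximalRealSubfield L)) L (IsCMField.complexConj L) 2), (((borelHeight ((quasiSplit (↥(maximalRealSubfield L)) L (IsCMField.complexConj L) 2).toAdelic
      (weylLongU ((IsCMField.complexConj L : L ≃ₐ[↥(maximalRealSubfield L)] L) : L →+* L) (rfl : (StdForm.antidiagonal 2).over L = (StdForm.antidiagonal 2).over L)) *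
        (v : (quasiSplit (↥(maximalRealSubfield L)) L (IsCMField.complexConj L) 2).Adelic))) : ℝ) : ℂ) ^ w ∂ν with hc
  have hcc : Continuous fun y : ℝ => c ((σ₀ : ℂ) + y * I) := continuous_intertwiningScalar_vertical_cm_two L ν h𝓕N h𝓕c hσ₀
  have hcb : ∀ y : ℝ, ‖c ((σ₀ : ℂ) + y * I)‖ ≤ ∫ v : ↥(adelicUnipotent (↥(maximalRealSubfield L)) L (IsCMField.complexConj L) 2), ((borelHeight ((quasiSplit (↥(maximalRealSubfield L)) L (IsCMField.complexConj L) 2).toAdelic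
      (weylLongU ((IsCMField.complexConj L : L ≃ₐ[↥(maximalRealSubfield L)] L) : L →+* L) (rfl : (StdForm.antidiagonal 2).over L = (StdForm.antidiagonal 2).over L)) *
        (v : (quasiSplit (↥(maximalRealSubfield L)) L (IsCMField.complexConj L) 2).Adelic))) : ℝ) ^ σ₀ ∂ν := fun y =>
    norm_intertwiningScalar_vertical_le_cm_two L ν σ₀ y
  have hcr : ∀ y : ℝ, conj (c (conj ((σ₀ : ℂ) + y * I))) = c ((σ₀ : ℂ) + y * I) := fun y => conj_integral_ofReal_cpow_conj ν _ _
  -- ★ B: the intertwined radial section is the radial function `M f′`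
  set M : ℝ → ℂ := fun r => (((2 * π)⁻¹ : ℝ) : ℂ) * ∫ y : ℝ, mellin f' (-((σ₀ : ℂ) + y * I)) * c ((σ₀ : ℂ) + y * I) * (r : ℂ) ^ (1 - ((σ₀ : ℂ) + y * I)) with hM
  have hMg : ∀ g : (quasiSplit (↥(maximalRealSubfield L)) L (IsCMField.complexConj L) 2).Adelic,
      ∫ v : ↥(adelicUnipotent (↥(maximalRealSubfield L)) L (IsCMField.complexConj L) 2), f' ((borelHeight ((quasiSplit (↥(maximalRealSubfield L)) L (IsCMField.complexConj L) 2).toAdelic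
        (weylLongU ((IsCMField.complexConj L : L ≃ₐ[↥(maximalRealSubfield L)] L) : L →+* L) (rfl : (StdForm.antidiagonal 2).over L = (StdForm.antidiagonal 2).over L)) *
          (v : (quasiSplit (↥(maximalRealSubfield L)) L (IsCMField.complexConj L) 2).Adelic) * g)) : ℝ) ∂ν = M (borelHeight g : ℝ) := fun g => by
    simp_rw [mul_assoc]
    exact integral_comp_borelHeight_weylLongU_eq_mellin_cm_two L ν h𝓕N h𝓕c hf' hf's hf'0 hσ₀ g
  -- the radial integrand `Ψ` and its regularity (§1)
  set Ψ : ℝ → ℂ := fun r => f r * conj (f' r + ((ν 𝓕).toReal⁻¹ : ℝ) • M r) with hΨ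
  have hMc : ∀ r : ℝ, 0 < r → ContinuousAt M r := fun r hr =>
    continuousAt_const.mul (continuousAt_integral_mellin_mul_cpow hf' hf's hf'0 hσ₀.le hcc hcb hr)
  have hΨc : Continuous Ψ :=
    continuous_mul_of_continuousAt_Ioi hf.continuous hf0 fun r hr =>
      continuous_conj.continuousAt.comp (hf'.continuous.continuousAt.add ((hMc r hr).const_smul ((ν 𝓕).toReal⁻¹ : ℝ)))
  have hΨs : HasCompactSupport Ψ := hfs.mul_right
  have hΨ0 : tsupport Ψ ⊆ Ioi 0 := tsupport_mul_subset_left.trans hf0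
  have hint : (fun g : (quasiSplit (↥(maximalRealSubfield L)) L (IsCMField.complexConj L) 2).Adelic => (β g).toReal • (f (borelHeight g : ℝ) * conj (f' (borelHeight g : ℝ) + ((ν 𝓕).toReal⁻¹ : ℝ) •
      ∫ v : ↥(adelicUnipotent (↥(maximalRealSubfield L)) L (IsCMField.complexConj L) 2), f' ((borelHeight ((quasiSplit (↥(maximalRealSubfield L)) L (IsCMField.complexConj L) 2).toAdelic
        (weylLongU ((IsCMField.complexConj L : L ≃ₐ[↥(maximalRealSubfield L)] L) : L →+* L) (rfl : (StdForm.antidiagonal 2).over L = (StdForm.antidiagonal 2).over L)) *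
          (v : (quasiSplit (↥(maximalRealSubfield L)) L (IsCMField.complexConj L) 2).Adelic) * g)) : ℝ) ∂ν))) =
      fun g => (β g).toReal • Ψ (borelHeight g : ℝ) := by
    funext g; rw [hMg g]
  rw [hint, hradial Ψ hΨc hΨs hΨ0, setIntegral_radialPairing_mul_cpow_eq hf hfs hf0 hf' hf's hf'0 hσ₀.le hcc hcb hcr ((ν 𝓕).toReal⁻¹)]

/-- **HEAD OF ED. 1 — THE INNER PRODUCT FORMULA FOR SPHERICAL PSEUDO-EISENSTEIN SERIES ON `U(1,1)_{L∕L⁺}`, LETTERS `hweight`, `hradial`** [MW II.2.1]: with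
`θ_f = E(f∘H)` (★ `eisensteinSeriesU`, LEFT convention), `f, f′ ∈ C²_c((0,∞))`, `σ₀ > 1`,
`⟪θ_f, θ_{f′}⟫_{L²(X,μ)} = c_μ·K_r·(2π)⁻¹ ∫_ℝ f̃(z)·(conj f̃′(1−z̄) + (ν𝓕)⁻¹·c(z)·conj f̃′(z̄)) dy`, `z = σ₀+iy`, `f̃ = mellin f (−·)`, `c(z) = ∫_{N(𝔸)} H(w₀v)^z dν`.
`hweight` = unfolding + adjunction + constant term (★ BochnerFin ∘ ★ hAVG ∘ ★ R3; ED. 2), `hradial` = Iwasawa∕Tate radial reduction (★ (δ)_two ∘ ★ (GR); ED. 3); the constant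
`c_μ·K_r` is independent of `β`, `f`, `f′`, `σ₀`. [cite: MoeglinWaldspurger1995, II.2.1] [cite: Garrett2018, §1.11, §2.8] [cite: Titchmarsh1948, Thm 71–72] -/
theorem pseudoEisenstein_inner_product_cm_two_of_letters
    (μ : Measure (quasiSplit (↥(maximalRealSubfield L)) L (IsCMField.complexConj L) 2).automorphicQuotient)
    (νG : Measure (quasiSplit (↥(maximalRealSubfield L)) L (IsCMField.complexConj L) 2).Adelic)
    (ν : Measure ↥(adelicUnipotent (↥(maximalRealSubfield L)) L (IsCMField.complexConj L) 2)) [ν.IsHaarMeasure] {𝓕 : Set ↥(adelicUnipotent (↥(maximalRealSubfield L)) L (IsCMField.complexConj L) 2)}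
    (h𝓕N : IsFundamentalDomain ↥(rationalUnipotent (↥(maximalRealSubfield L)) L (IsCMField.complexConj L) 2) 𝓕 ν) (h𝓕c : IsCompact (closure 𝓕))
    {f f' : ℝ → ℂ} (hf : ContDiff ℝ 2 f) (hfs : HasCompactSupport f) (hf0 : tsupport f ⊆ Ioi 0) (hf' : ContDiff ℝ 2 f') (hf's : HasCompactSupport f') (hf'0 : tsupport f' ⊆ Ioi 0)
    {σ₀ : ℝ} (hσ₀ : 1 < σ₀) (β : (quasiSplit (↥(maximalRealSubfield L)) L (IsCMField.complexConj L) 2).Adelic → ℝ≥0∞) {cμ Kr : ℂ}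
    (hweight : ∫ x, (quasiSplit (↥(maximalRealSubfield L)) L (IsCMField.complexConj L) 2).quotFun (eisensteinSeriesU fun g => f (borelHeight g : ℝ)) x *
        conj ((quasiSplit (↥(maximalRealSubfield L)) L (IsCMField.complexConj L) 2).quotFun (eisensteinSeriesU fun g => f' (borelHeight g : ℝ)) x) ∂μ =
      cμ * ∫ g, (β g).toReal • (f (borelHeight g : ℝ) * conj (f' (borelHeight g : ℝ) + ((ν 𝓕).toReal⁻¹ : ℝ) •
        ∫ v : ↥(adelicUnipotent (↥(maximalRealSubfield L)) L (IsCMField.complexConj L) 2), f' ((borelHeight ((quasiSplit (↥(maximalRealSubfield L)) L (IsCMField.complexConj L) 2).toAdelic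
          (weylLongU ((IsCMField.complexConj L : L ≃ₐ[↥(maximalRealSubfield L)] L) : L →+* L) (rfl : (StdForm.antidiagonal 2).over L = (StdForm.antidiagonal 2).over L)) *
            (v : (quasiSplit (↥(maximalRealSubfield L)) L (IsCMField.complexConj L) 2).Adelic) * g)) : ℝ) ∂ν)) ∂νG)
    (hradial : ∀ Ψ : ℝ → ℂ, Continuous Ψ → HasCompactSupport Ψ → tsupport Ψ ⊆ Ioi 0 →
      ∫ g, (β g).toReal • Ψ (borelHeight g : ℝ) ∂νG = Kr * ∫ r in Ioi (0 : ℝ), Ψ r * (r : ℂ) ^ (-2 : ℂ)) :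
    ∫ x, (quasiSplit (↥(maximalRealSubfield L)) L (IsCMField.complexConj L) 2).quotFun (eisensteinSeriesU fun g => f (borelHeight g : ℝ)) x *
        conj ((quasiSplit (↥(maximalRealSubfield L)) L (IsCMField.complexConj L) 2).quotFun (eisensteinSeriesU fun g => f' (borelHeight g : ℝ)) x) ∂μ =
      cμ * Kr * ((((2 * π)⁻¹ : ℝ) : ℂ) * ∫ y : ℝ, mellin f (-((σ₀ : ℂ) + y * I)) *
        (conj (mellin f' (-(1 - conj ((σ₀ : ℂ) + y * I)))) + (((ν 𝓕).toReal⁻¹ : ℝ) : ℂ) *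
          (∫ v : ↥(adelicUnipotent (↥(maximalRealSubfield L)) L (IsCMField.complexConj L) 2), (((borelHeight ((quasiSplit (↥(maximalRealSubfield L)) L (IsCMField.complexConj L) 2).toAdelic
            (weylLongU ((IsCMField.complexConj L : L ≃ₐ[↥(maximalRealSubfield L)] L) : L →+* L) (rfl : (StdForm.antidiagonal 2).over L = (StdForm.antidiagonal 2).over L)) *
              (v : (quasiSplit (↥(maximalRealSubfield L)) L (IsCMField.complexConj L) 2).Adelic))) : ℝ) : ℂ) ^ (((σ₀ : ℂ) + y * I)) ∂ν) *
          conj (mellin f' (-conj ((σ₀ : ℂ) + y * I))))) := by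
  rw [hweight, integral_weight_smul_radialPairing_eq_mellin_cm_two L ν h𝓕N h𝓕c hf hfs hf0 hf' hf's hf'0 hσ₀ νG β hradial, mul_assoc]

end CM

end Summit.HodgeConjecture.HodgeConjecture.Cruxes.H413.K2E1PseudoEisensteinInnerProductCMTwo

end
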